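import Summits.NavierStokesRegularity.NavierStokesRegularity.Theorems.ApexLocalisation.Negative.BridgeVacuity
import Literature.Analysis.FluidPDE.LocalTypeICongr

/-!
# `ApexLocalisation` (crux stmt-NavierStokesRegularity-11719): the PICKED line `decaying-ancient-bridge`
# — blow-down modulo the engine (closes `stub_apexOfDecaying`) and route-optimality of the bet
# — negative-side support (drefute seat, gen 3)

Companion of `Negative/BridgeTargets.lean` / `Negative/BridgeVacuity.lean` for the lead's skeleton
`Cruxes/ApexLocalisation/Lines/decaying-ancient-bridge.lean` (sha `adc980f7…`, stubs `stub_slabCompactness`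
(ENGINE), `stub_rateToAncient`, `stub_radiationBound`, `stub_hullSelection` (THE BET), `stub_hullClosed`,
`stub_apexOfDecaying`). All sorry-free.

* §0 the stub statements as named propositions, VERBATIM (`SlabEngine`, `RateToAncientCore`,
  `HullSelectionCore`, `HullClosureCore`, `ApexOfDecayingCore`; conformance `Iff.rfl` examples at the end),
  and the one further analytic input `ClassGivesRateProfile` ("every non-trivial member of the line's class
  𝒜(C,B) = `InBridgeClass` yields a rate-Type-I singular slab profile").
* §2 **BLOW-DOWN MODULO THE ENGINE** (`blowDown_of_slabEngine`): granted `SlabEngine`, any suitable weak slab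
  solution with weak gradient, `𝐈 < ⊤`, not a.e. zero, all of whose Navier–Stokes zooms about the origin
  `c N(c²t, cx)` (`c ≥ 1`) obey a fixed majorant `F`, blows down to a suitable weak slab solution with
  `𝐈 < ⊤`, backward-singular at the origin, obeying `F` a.e. (Albritton–Barker 2019 §3, reverse direction,
  run on the whole slab: zoom covariance `zoom_isSuitableWeakSolutionOn`, `typeIBound_lowerHalf_nsZoom`,
  persistence through `‖v_k‖_{L^∞(Q(0,R))} → ∞` (`tendsto_eLpNorm_top_originZoom_atTop`), a.e. limits of
  the `L³_loc` limits ball by ball). Corollaries: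
  - `apexOfDecayingCore_of_slabEngine` : **`stub_apexOfDecaying` holds outright** — its own antecedent is
    the engine; `F = C'/(‖x‖+√(−t))` from the shifted decay (`c C'/(1+c‖x‖+c√−t) ≤ C'/(‖x‖+√−t)`) and
    `exists_apex_profile_repr`. (The verbatim type of the stub is the last-but-three `example`.)
  - `classGivesRateProfile_of_slabEngine` : `SlabEngine → ClassGivesRateProfile` (`F = C/√(−t)`,
    `exists_rate_profile_repr`) — A–B Thm 1.1 reverse WITH the rate, for 𝒜(C,B).
* §1/§3 **ROUTE-OPTIMALITY OF THE BET.** `apexLocalisation_of_cores` (the lead's composition over the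
  cores); `hullSelectionCore_of_target_of_crux` (under the route target `X = RellichScar.NoApexTypeIProfile`
  the crux makes every 𝒜(C,B) trivial, so the bet holds vacuously); hence
  `hullSelectionCore_iff_crux_of_target` / `bet_iff_crux_of_target` : **engine, ⇒ transfer and hull
  closure granted, under `X` the bet ⇔ the crux**, and `not_target_of_crux_of_not_hullSelectionCore` /
  `bet_failure_dichotomy` : a failure of the bet exhibits an apex profile (route dead) or kills the crux.
  Reading: the bet is stated in ∀-form over 𝒜(C,B) and is, in the abstract, STRONGER than the ∃→∃ crux
  (one localisable and one "daughter-gas" Type-I ancient solution would separate them) — but every such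
  separating world has `¬X`, where the route `RellichScar` is dead anyway. For the route the bet carries
  no risk beyond the crux; no weakening of `stub_hullSelection` is worth looking for on that account.

## References

* D. Albritton, T. Barker, J. Math. Fluid Mech. 21 (2019) = arXiv:1811.00502, Thm 1.1, Lemma 2.2,
  Prop. 2.3, §3. [AlbrittonBarker2019]
* G. Koch, N. Nadirashvili, G. Seregin, V. Šverák, Acta Math. 203 (2009), (1.4), (1.6), §6. [KNSS2009]
-/

set_option linter.dupNamespace false

noncomputable section

open MeasureTheory TopologicalSpace Set Function Filter Topology Metric
open scoped InnerProductSpace RealInnerProductSpace ENNReal NNReal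
open Literature.Analysis Literature.Analysis.FluidPDE
open Summit.NavierStokesRegularity.NavierStokesRegularity.Theses

namespace Summit.NavierStokesRegularity.NavierStokesRegularity.Theorems.ApexLocalisation.Negative

/-- Physical space (the skeleton writes `E³`). -/
local notation "E³" => EuclideanSpace ℝ (Fin 3)

/-! ## §0 The stub statements as named propositions (verbatim from the skeleton) -/

/-- `stub_slabCompactness` (the ENGINE), verbatim. -/
def SlabEngine : Prop :=
  ∀ (I : ℝ≥0∞) (v : ℕ → ℝ → E³ → E³) (q : ℕ → ℝ → E³ → ℝ) (G : ℕ → ℝ → E³ → E³ →L[ℝ] E³),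
      I < ⊤ →
      (∀ k, IsSuitableWeakSolutionOn (slab E³ (Iio 0) isOpen_Iio) 1 0 (v k) (q k)) →
      (∀ k, HasWeakSpatialGradientOn (slab E³ (Iio 0) isOpen_Iio) (v k) (G k)) →
      (∀ k, typeIBound (Iio (0 : ℝ) ×ˢ univ) (v k) (q k) (G k) ≤ I) →
      ∃ (u : ℝ → E³ → E³) (p : ℝ → E³ → ℝ) (H : ℝ → E³ → E³ →L[ℝ] E³) (σ : ℕ → ℕ),
        StrictMono σ ∧
        IsSuitableWeakSolutionOn (slab E³ (Iio 0) isOpen_Iio) 1 0 u p ∧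
        HasWeakSpatialGradientOn (slab E³ (Iio 0) isOpen_Iio) u H ∧
        typeIBound (Iio (0 : ℝ) ×ˢ univ) u p H ≤ 4 * I ∧
        (∀ R : ℝ, 0 < R → Tendsto (fun j => eLpNorm (uncurry (v (σ j)) - uncurry u) 3
          (volume.restrict (parabolicCylinder R (0 : ℝ × E³)))) atTop (𝓝 0)) ∧
        ((∀ R : ℝ, 0 < R → limsup (fun j => eLpNorm (uncurry (v (σ j))) ⊤
            (volume.restrict (parabolicCylinder R (0 : ℝ × E³)))) atTop = ⊤) →
          IsBackwardSingularPoint u 0)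

/-- The consequent of `stub_rateToAncient` (⇒ TRANSFER) after the engine is fed, verbatim
(antecedent = `∃ u p G, IsRateProfile C u p G`, conclusion over `InBridgeClass` — both by `Iff.rfl`). -/
def RateToAncientCore : Prop :=
  ∀ C : ℝ,
      (∃ (u : ℝ → E³ → E³) (p : ℝ → E³ → ℝ) (G : ℝ → E³ → E³ →L[ℝ] E³),
        IsSuitableWeakSolutionOn (slab E³ (Iio 0) isOpen_Iio) 1 0 u p ∧
        HasWeakSpatialGradientOn (slab E³ (Iio 0) isOpen_Iio) u G ∧
        typeIBound (Iio (0 : ℝ) ×ˢ univ) u p G < ⊤ ∧ HasTypeITimeDecay C u ∧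
        IsBackwardSingularPoint u 0) →
      ∃ (B : ℝ) (M : ℝ → E³ → E³), InBridgeClass C B M ∧ (∃ s : ℝ, s < 0 ∧ ∃ y : E³, M s y ≠ 0)

/-- The consequent of `stub_hullSelection` (THE BET) after the radiation bound is fed, verbatim. -/
def HullSelectionCore : Prop :=
  ∀ (C B : ℝ) (M : ℝ → E³ → E³), InBridgeClass C B M →
      (∃ s : ℝ, s < 0 ∧ ∃ y : E³, M s y ≠ 0) →
      ∃ (xk : ℕ → E³) (tk : ℕ → ℝ) (lk : ℕ → ℝ) (N : ℝ → E³ → E³),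
        (∀ k, tk k ≤ 0 ∧ 0 < lk k ∧ lk k ≤ 1) ∧
        (∀ t < 0, TendstoLocallyUniformly
          (fun k (y : E³) => lk k • M (tk k + lk k ^ 2 * t) (xk k + lk k • y)) (N t) atTop) ∧
        ContinuousOn (uncurry N) (Iio (0 : ℝ) ×ˢ univ) ∧
        (∃ s : ℝ, s < 0 ∧ ∃ y : E³, N s y ≠ 0) ∧
        ∃ K : ℝ, ∀ s < 0, ∀ y : E³, ‖y‖ * ‖N s y‖ ≤ K

/-- The consequent of `stub_hullClosed` (HULL CLOSURE) after the engine is fed, verbatim. -/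
def HullClosureCore : Prop :=
  ∀ (C B : ℝ) (M : ℝ → E³ → E³) (xk : ℕ → E³) (tk : ℕ → ℝ) (lk : ℕ → ℝ) (N : ℝ → E³ → E³),
      InBridgeClass C B M →
      (∀ k, tk k ≤ 0 ∧ 0 < lk k ∧ lk k ≤ 1) →
      (∀ t < 0, TendstoLocallyUniformly
        (fun k (y : E³) => lk k • M (tk k + lk k ^ 2 * t) (xk k + lk k • y)) (N t) atTop) →
      ContinuousOn (uncurry N) (Iio (0 : ℝ) ×ˢ univ) →
      InBridgeClass C B N

/-- The consequent of `stub_apexOfDecaying` (⇐ TRANSFER) after the engine is fed, verbatim. -/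
def ApexOfDecayingCore : Prop :=
  (∃ (C' : ℝ) (N : ℝ → E³ → E³) (q : ℝ → E³ → ℝ) (H : ℝ → E³ → E³ →L[ℝ] E³),
      IsSuitableWeakSolutionOn (slab E³ (Iio 0) isOpen_Iio) 1 0 N q ∧
      HasWeakSpatialGradientOn (slab E³ (Iio 0) isOpen_Iio) N H ∧
      typeIBound (Iio (0 : ℝ) ×ˢ univ) N q H < ⊤ ∧
      ¬ (uncurry N =ᵐ[volume.restrict (Iio (0 : ℝ) ×ˢ (univ : Set E³))] 0) ∧
      ∀ t : ℝ, t < 0 → ∀ x : E³, ‖N t x‖ ≤ C' / (1 + ‖x‖ + Real.sqrt (-t))) →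
    ∃ (C' : ℝ) (u : ℝ → E³ → E³) (p : ℝ → E³ → ℝ) (G : ℝ → E³ → E³ →L[ℝ] E³),
      IsSuitableWeakSolutionOn (slab E³ (Iio 0) isOpen_Iio) 1 0 u p ∧
      HasWeakSpatialGradientOn (slab E³ (Iio 0) isOpen_Iio) u G ∧
      typeIBound (Iio (0 : ℝ) ×ˢ univ) u p G < ⊤ ∧ HasTypeIDecay C' u ∧
      IsBackwardSingularPoint u 0

/-- **A–B reverse WITH the rate, for the line's class** (the one analytic input of §1 that is not a
stub of the line; discharged modulo the engine in §2): every non-trivial member of 𝒜(C,B) yields a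
rate-Type-I singular slab profile. -/
def ClassGivesRateProfile : Prop :=
  ∀ (C B : ℝ) (M : ℝ → E³ → E³), InBridgeClass C B M →
    (∃ s : ℝ, s < 0 ∧ ∃ y : E³, M s y ≠ 0) → RateProfileExists

/-! ## §1 Route-optimality of the bet (pure logic over the named propositions) -/

/-- Glue (the lead's `shiftedDecay_of_bounds`, verbatim): `‖N‖ ≤ B`, the rate `C` and
`‖y‖‖N‖ ≤ K` give the shifted decay `(B + C + K)/(1 + ‖y‖ + √(−t))`. -/
theorem shiftedDecay_of_bounds' {N : ℝ → E³ → E³} {B C K : ℝ}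
    (hB : ∀ t < 0, ∀ x : E³, ‖N t x‖ ≤ B) (hC : HasTypeITimeDecay C N)
    (hK : ∀ s < 0, ∀ y : E³, ‖y‖ * ‖N s y‖ ≤ K) :
    ∀ t : ℝ, t < 0 → ∀ x : E³, ‖N t x‖ ≤ (B + C + K) / (1 + ‖x‖ + Real.sqrt (-t)) := by
  intro t ht x
  have hs : 0 < Real.sqrt (-t) := Real.sqrt_pos.2 (by linarith)
  have hden : 0 < 1 + ‖x‖ + Real.sqrt (-t) := by positivity
  rw [le_div_iff₀ hden]
  have h1 := hB t ht x
  have h2 : Real.sqrt (-t) * ‖N t x‖ ≤ C := by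
    have := hC t ht x
    rwa [le_div_iff₀ hs, mul_comm] at this
  have h3 := hK t ht x
  nlinarith [norm_nonneg (N t x), norm_nonneg x]

/-- **The composition with the cores** (= the lead's `ApexLocalisation_of`, engine and radiation bound
already fed): ⇒ transfer, the bet, hull closure and ⇐ transfer imply the crux. -/
theorem apexLocalisation_of_cores (h1 : RateToAncientCore) (h3 : HullSelectionCore)
    (h4 : HullClosureCore) (h5 : ApexOfDecayingCore) : RellichScar.ApexLocalisation := by
  intro C hRate
  obtain ⟨B, M, hM, hMnt⟩ := h1 C hRate
  obtain ⟨xk, tk, lk, N, hadm, hconv, hNcont, hNnt, K, hK⟩ := h3 C B M hM hMnt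
  obtain ⟨-, -, -, hNB, hNC, q, H, hsws, hgrad, hI⟩ := h4 C B M xk tk lk N hM hadm hconv hNcont
  have hdecay := shiftedDecay_of_bounds' hNB hNC hK
  obtain ⟨s, hs, y, hy⟩ := hNnt
  have hnt := not_ae_eq_zero_of_continuousOn_slab hNcont hs hy
  exact h5 ⟨B + C + K, N, q, H, hsws, hgrad, hI, hnt, hdecay⟩

/-- **Under the route target, the crux makes 𝒜(C,B) trivial**: `X ∧ crux ⇒ ¬RateProfileExists`
(landed `not_rateProfileExists_iff_target_and_crux`), and by `ClassGivesRateProfile` every member of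
every 𝒜(C,B) then vanishes on the slab. -/
theorem inBridgeClass_trivial_of_target_of_crux (hG : ClassGivesRateProfile)
    (hX : RellichScar.NoApexTypeIProfile) (hcrux : RellichScar.ApexLocalisation)
    {C B : ℝ} {M : ℝ → E³ → E³} (hM : InBridgeClass C B M) : ∀ s < 0, ∀ y : E³, M s y = 0 := by
  have hno : ¬ RateProfileExists := not_rateProfileExists_iff_target_and_crux.2 ⟨hX, hcrux⟩
  intro s hs y
  by_contra hy
  exact hno (hG C B M hM ⟨s, hs, y, hy⟩)

/-- **Under the route target, the crux implies the bet** (vacuously: there is nothing to select from). -/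
theorem hullSelectionCore_of_target_of_crux (hG : ClassGivesRateProfile)
    (hX : RellichScar.NoApexTypeIProfile) (hcrux : RellichScar.ApexLocalisation) :
    HullSelectionCore := by
  intro C B M hM hMnt
  obtain ⟨s, hs, y, hy⟩ := hMnt
  exact absurd (inBridgeClass_trivial_of_target_of_crux hG hX hcrux hM s hs y) hy

/-- **ROUTE-OPTIMALITY OF THE BET.** Granted the line's known stubs (⇒ transfer, hull closure,
⇐ transfer — engine fed) and `ClassGivesRateProfile`, UNDER THE ROUTE TARGET `X` the bet is
EQUIVALENT to the crux. -/
theorem hullSelectionCore_iff_crux_of_target (h1 : RateToAncientCore) (h4 : HullClosureCore)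
    (h5 : ApexOfDecayingCore) (hG : ClassGivesRateProfile) (hX : RellichScar.NoApexTypeIProfile) :
    HullSelectionCore ↔ RellichScar.ApexLocalisation :=
  ⟨fun h3 => apexLocalisation_of_cores h1 h3 h4 h5, hullSelectionCore_of_target_of_crux hG hX⟩

/-- **Where the bet can fail while the crux holds: only off the route.** If the bet is false but the
crux is true then the route target `X` is false (an apex profile exists) — i.e. the route `RellichScar`
is dead in every such world. -/
theorem not_target_of_crux_of_not_hullSelectionCore (hG : ClassGivesRateProfile)
    (h3 : ¬ HullSelectionCore) (hcrux : RellichScar.ApexLocalisation) :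
    ¬ RellichScar.NoApexTypeIProfile :=
  fun hX => h3 (hullSelectionCore_of_target_of_crux hG hX hcrux)

/-- The same, positively: a failure of the bet exhibits an apex profile or kills the crux. -/
theorem apexProfileExists_or_not_crux_of_not_hullSelectionCore (hG : ClassGivesRateProfile)
    (h3 : ¬ HullSelectionCore) : ApexProfileExists ∨ ¬ RellichScar.ApexLocalisation := by
  by_cases hcrux : RellichScar.ApexLocalisation
  · left
    have := not_target_of_crux_of_not_hullSelectionCore hG h3 hcrux
    rwa [noApexTypeIProfile_iff, not_not] at this
  · exact Or.inr hcrux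

/-- Under the target, the bet is also equivalent to "𝒜 is trivial" (every member of every 𝒜(C,B)
vanishes on the slab), granted hull closure and the ⇐ transfer only. -/
theorem hullSelectionCore_iff_trivial_of_target (h4 : HullClosureCore) (h5 : ApexOfDecayingCore)
    (hX : RellichScar.NoApexTypeIProfile) :
    HullSelectionCore ↔
      ∀ (C B : ℝ) (M : ℝ → E³ → E³), InBridgeClass C B M → ∀ s < 0, ∀ y : E³, M s y = 0 := by
  constructor
  · intro h3 C B M hM s hs y
    by_contra hy
    obtain ⟨xk, tk, lk, N, hadm, hconv, hNcont, hNnt, K, hK⟩ := h3 C B M hM ⟨s, hs, y, hy⟩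
    obtain ⟨-, -, -, hNB, hNC, q, H, hsws, hgrad, hI⟩ := h4 C B M xk tk lk N hM hadm hconv hNcont
    have hdecay := shiftedDecay_of_bounds' hNB hNC hK
    obtain ⟨s', hs', y', hy'⟩ := hNnt
    have hnt := not_ae_eq_zero_of_continuousOn_slab hNcont hs' hy'
    obtain ⟨C', u, p, G, h⟩ := h5 ⟨B + C + K, N, q, H, hsws, hgrad, hI, hnt, hdecay⟩
    exact (noApexTypeIProfile_iff.1 hX) ⟨C', u, p, G, h⟩
  · intro htriv C B M hM hMnt
    obtain ⟨s, hs, y, hy⟩ := hMnt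
    exact absurd (htriv C B M hM s hs y) hy

/-! ## §2 Blow-down modulo the engine -/

/-- **Blow-up of the `L^∞` norms along zooms ABOUT THE ORIGIN** (variant of the tree's
`tendsto_eLpNorm_top_nsZoom_atTop`, which zooms about the non-triviality centre `z₁` itself): if
`‖u‖_{L^∞(Q(z₁,1))} ≠ 0` for some `z₁` with `t₁ < 0` and `c_k → ∞`, then
`‖c_k u(c_k² ·, c_k ·)‖_{L^∞(Q(0,R))} = c_k ‖u‖_{L^∞(Q(0,c_k R))} → ∞`, because `Q(z₁,1) ⊆ Q(0, c_k R)`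
eventually. -/
theorem tendsto_eLpNorm_top_originZoom_atTop {u : ℝ → E³ → E³} {z₁ : ℝ × E³} (hz₁ : z₁.1 < 0)
    {c : ℕ → ℝ} (hc : ∀ k, 0 < c k) (hctop : Tendsto c atTop atTop)
    (hN : eLpNorm (uncurry u) ∞ (volume.restrict (parabolicCylinder 1 z₁)) ≠ 0) {R : ℝ}
    (hR : 0 < R) :
    Tendsto (fun k => eLpNorm (uncurry ((c k) • stPull (c k ^ 2) (c k) 0 (0 : E³) u)) ∞
      (volume.restrict (parabolicCylinder R 0))) atTop (𝓝 ∞) := by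
  set N := eLpNorm (uncurry u) ∞ (volume.restrict (parabolicCylinder 1 z₁)) with hNdef
  have hb : Tendsto (fun k => ENNReal.ofReal (c k) * N) atTop (𝓝 ∞) := by
    have h1 : Tendsto (fun k => ENNReal.ofReal (c k)) atTop (𝓝 ∞) :=
      ENNReal.tendsto_ofReal_atTop.comp hctop
    have h2 := ENNReal.Tendsto.mul_const h1 (Or.inl ENNReal.top_ne_zero) (b := N)
    rwa [ENNReal.top_mul hN] at h2
  refine tendsto_nhds_top_mono hb ?_
  -- eventually `c_k R ≥ A := 2 - t₁ + ‖x₁‖`, and then `Q(z₁,1) ⊆ Q(0, c_k R)`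
  set A : ℝ := 2 - z₁.1 + ‖z₁.2‖ with hA
  have hA1 : 1 ≤ A := by
    have := norm_nonneg z₁.2
    rw [hA]; linarith
  filter_upwards [hctop.eventually_ge_atTop (A / R)] with k hk
  have hcR : A ≤ c k * R := by
    have := mul_le_mul_of_nonneg_right hk hR.le
    rwa [div_mul_cancel₀ _ hR.ne'] at this
  have h0 : stAffine (c k ^ 2) (c k) 0 (0 : E³) 0 = 0 := by
    ext <;> simp [stAffine]
  rw [eLpNorm_top_nsZoom (hc k) 0 (0 : E³) R 0, h0]
  gcongr
  refine eLpNorm_mono_measure _ (Measure.restrict_mono ?_ le_rfl)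
  -- `Q(z₁, 1) ⊆ Q(0, c_k R)`
  intro w hw
  rw [mem_parabolicCylinder] at hw ⊢
  obtain ⟨⟨hw1, hw2⟩, hw3⟩ := hw
  have hsq : A ≤ (c k * R) ^ 2 := by nlinarith
  refine ⟨⟨?_, ?_⟩, ?_⟩
  · simp only [Prod.fst_zero]
    rw [hA] at hsq
    have := norm_nonneg z₁.2
    linarith
  · simp only [Prod.fst_zero]
    linarith
  · simp only [Prod.snd_zero]
    calc dist w.2 0 ≤ dist w.2 z₁.2 + dist z₁.2 0 := dist_triangle _ _ _
      _ < 1 + ‖z₁.2‖ := by rw [dist_zero_right]; linarith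
      _ ≤ c k * R := by rw [hA] at hcR; linarith

/-- The slab `(-∞,0) × ℝ³` is covered by the parabolic balls `Q(0, n+1)`. -/
theorem slab_subset_iUnion_parabolicCylinder :
    (Iio (0 : ℝ) ×ˢ (univ : Set E³)) ⊆ ⋃ n : ℕ, parabolicCylinder ((n : ℝ) + 1) (0 : ℝ × E³) := by
  rintro ⟨t, x⟩ ⟨ht, -⟩
  simp only [mem_Iio] at ht
  obtain ⟨n, hn⟩ := exists_nat_gt (max (-t) ‖x‖)
  have hn1 : -t < n := lt_of_le_of_lt (le_max_left _ _) hn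
  have hn2 : ‖x‖ < n := lt_of_le_of_lt (le_max_right _ _) hn
  refine mem_iUnion.2 ⟨n, ?_⟩
  rw [mem_parabolicCylinder]
  refine ⟨⟨?_, by simpa using ht⟩, ?_⟩
  · simp only [Prod.fst_zero]
    have h0 : (0 : ℝ) ≤ n := n.cast_nonneg
    nlinarith
  · simpa [dist_zero_right] using (hn2.trans (by linarith : (n : ℝ) < n + 1))

/-- **BLOW-DOWN MODULO THE ENGINE.** Granted `SlabEngine` (`stub_slabCompactness`), a suitable weak
slab solution `N` with weak gradient, `𝐈 < ⊤`, not a.e. zero, all of whose NS zooms about the origin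
`c N(c²t, cx)`, `c ≥ 1`, obey a fixed majorant `F`, blows down (along `c_k = k+1`, then the engine's
subsequence) to a suitable weak slab solution with `𝐈 < ⊤`, backward-singular at the origin
(persistence: `‖v_k‖_{L^∞(Q(0,R))} → ∞`) and obeying `F` almost everywhere on the slab (a.e.
limits of `L³_loc` limits). -/
theorem blowDown_of_slabEngine (hE : SlabEngine)
    {N : ℝ → E³ → E³} {q : ℝ → E³ → ℝ} {H : ℝ → E³ → E³ →L[ℝ] E³}
    (hsws : IsSuitableWeakSolutionOn (slab E³ (Iio 0) isOpen_Iio) 1 0 N q)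
    (hgrad : HasWeakSpatialGradientOn (slab E³ (Iio 0) isOpen_Iio) N H)
    (hI : typeIBound (Iio (0 : ℝ) ×ˢ univ) N q H < ⊤)
    (hnt : ¬ (uncurry N =ᵐ[volume.restrict (Iio (0 : ℝ) ×ˢ (univ : Set E³))] 0))
    {F : ℝ × E³ → ℝ}
    (hF : ∀ c : ℝ, 1 ≤ c → ∀ t : ℝ, t < 0 → ∀ x : E³, ‖c • N (c ^ 2 * t) (c • x)‖ ≤ F (t, x)) :
    ∃ (u : ℝ → E³ → E³) (p : ℝ → E³ → ℝ) (G : ℝ → E³ → E³ →L[ℝ] E³),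
      IsSuitableWeakSolutionOn (slab E³ (Iio 0) isOpen_Iio) 1 0 u p ∧
      HasWeakSpatialGradientOn (slab E³ (Iio 0) isOpen_Iio) u G ∧
      typeIBound (Iio (0 : ℝ) ×ˢ univ) u p G < ⊤ ∧ IsBackwardSingularPoint u 0 ∧
      ∀ᵐ w ∂(volume.restrict (Iio (0 : ℝ) ×ˢ (univ : Set E³))), ‖uncurry u w‖ ≤ F w := by
  set I := typeIBound (Iio (0 : ℝ) ×ˢ (univ : Set E³)) N q H with hIdef
  -- non-triviality centre
  have hNm : AEStronglyMeasurable (uncurry N) (volume.restrict (Iio (0 : ℝ) ×ˢ (univ : Set E³))) :=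
    hgrad.locallyIntegrableOn.aestronglyMeasurable
  obtain ⟨z₁, hz₁, hNz⟩ := exists_center_eLpNorm_top_ne_zero hNm hnt
  -- the blow-down family about the origin
  set c : ℕ → ℝ := fun k => (k : ℝ) + 1 with hc
  have hcpos : ∀ k, 0 < c k := fun k => by positivity
  have hc1 : ∀ k, 1 ≤ c k := fun k => by
    show (1 : ℝ) ≤ (k : ℝ) + 1
    have : (0 : ℝ) ≤ k := k.cast_nonneg
    linarith
  have hctop : Tendsto c atTop atTop :=
    tendsto_atTop_add_const_right _ _ tendsto_natCast_atTop_atTop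
  set v : ℕ → ℝ → E³ → E³ := fun k => c k • stPull (c k ^ 2) (c k) 0 (0 : E³) N with hv
  set qk : ℕ → ℝ → E³ → ℝ := fun k => c k ^ 2 • stPull (c k ^ 2) (c k) 0 (0 : E³) q with hqk
  set Gk : ℕ → ℝ → E³ → E³ →L[ℝ] E³ := fun k => c k ^ 2 • stPull (c k ^ 2) (c k) 0 (0 : E³) H with hGk
  have hslab : ∀ k, stPreimage (c k ^ 2) (c k) 0 (0 : E³) (slab E³ (Iio 0) isOpen_Iio) =
      slab E³ (Iio 0) isOpen_Iio := fun k =>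
    TopologicalSpace.Opens.ext (stAffine_preimage_lowerHalf (hcpos k))
  have hswsk : ∀ k, IsSuitableWeakSolutionOn (slab E³ (Iio 0) isOpen_Iio) 1 0 (v k) (qk k) := by
    intro k
    have h := zoom_isSuitableWeakSolutionOn hsws (hcpos k) 0 (0 : E³)
    rwa [hslab k] at h
  have hgradk : ∀ k, HasWeakSpatialGradientOn (slab E³ (Iio 0) isOpen_Iio) (v k) (Gk k) := by
    intro k
    have h := zoom_hasWeakSpatialGradientOn hgrad (hcpos k) 0 (0 : E³)
    rwa [hslab k] at h
  have hIk : ∀ k, typeIBound (Iio (0 : ℝ) ×ˢ univ) (v k) (qk k) (Gk k) ≤ I := fun k =>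
    (typeIBound_lowerHalf_nsZoom (hcpos k) N q H).le
  -- the engine
  obtain ⟨u, p, G, σ, hσ, hsws', hgrad', hI', hconv, hpers⟩ := hE I v qk Gk hI hswsk hgradk hIk
  -- persistence: the origin is backward-singular
  have hsing : IsBackwardSingularPoint u 0 := by
    refine hpers fun R hR => ?_
    exact (tendsto_eLpNorm_top_originZoom_atTop (u := N) hz₁ (fun j => hcpos (σ j))
      (hctop.comp hσ.tendsto_atTop) hNz hR).limsup_eq
  -- the majorant passes to the limit a.e., ball by ball
  have hbound : ∀ k (w : ℝ × E³), w.1 < 0 → ‖uncurry (v k) w‖ ≤ F w := by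
    rintro k ⟨t, x⟩ ht
    have h := hF (c k) (hc1 k) t ht x
    simpa [hv, stPull_apply] using h
  have hball : ∀ n : ℕ, ∀ᵐ w ∂(volume.restrict (parabolicCylinder ((n : ℝ) + 1) (0 : ℝ × E³))),
      ‖uncurry u w‖ ≤ F w := by
    intro n
    set Q : Set (ℝ × E³) := parabolicCylinder ((n : ℝ) + 1) (0 : ℝ × E³) with hQ
    have hQslab : Q ⊆ Iio (0 : ℝ) ×ˢ (univ : Set E³) := parabolicCylinder_origin_subset_slab _
    have hQmeas : MeasurableSet Q := by
      rw [hQ]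
      exact measurableSet_Ioo.prod measurableSet_ball
    have hvm : ∀ j, AEStronglyMeasurable (uncurry (v (σ j))) (volume.restrict Q) := fun j =>
      ((hgradk (σ j)).locallyIntegrableOn.aestronglyMeasurable).mono_measure
        (Measure.restrict_mono hQslab le_rfl)
    have hum : AEStronglyMeasurable (uncurry u) (volume.restrict Q) :=
      (hgrad'.locallyIntegrableOn.aestronglyMeasurable).mono_measure
        (Measure.restrict_mono hQslab le_rfl)
    have hTIM : TendstoInMeasure (volume.restrict Q) (fun j => uncurry (v (σ j))) atTop (uncurry u) :=
      tendstoInMeasure_of_tendsto_eLpNorm (by norm_num) hvm hum (hconv ((n : ℝ) + 1) (by positivity))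
    obtain ⟨ns, -, hae⟩ := hTIM.exists_seq_tendsto_ae
    filter_upwards [hae, ae_restrict_mem hQmeas] with w hw hwQ
    have hw1 : w.1 < 0 := (hQslab hwQ).1
    exact le_of_tendsto' hw.norm fun i => hbound _ w hw1
  have hae : ∀ᵐ w ∂(volume.restrict (Iio (0 : ℝ) ×ˢ (univ : Set E³))), ‖uncurry u w‖ ≤ F w :=
    ae_restrict_of_ae_restrict_of_subset slab_subset_iUnion_parabolicCylinder
      ((ae_restrict_iUnion_iff _ _).2 hball)
  refine ⟨u, p, G, hsws', hgrad', lt_of_le_of_lt hI' ?_, hsing, hae⟩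
  exact ENNReal.mul_lt_top (by simp) hI

/-- **`stub_apexOfDecaying` holds outright** (candidate proof for the lead; the stub is
`SlabEngine → ApexOfDecayingCore` verbatim): the shifted decay `C'/(1+‖x‖+√(−t))` of `N` gives the
exact apex bound `C'/(‖x‖+√(−t))` for every zoom `c ≥ 1` (`c C'/(1 + c‖x‖ + c√−t) ≤ C'/(‖x‖+√−t)`),
the blow-down obeys it a.e., and `exists_apex_profile_repr` picks the pointwise representative. -/
theorem apexOfDecayingCore_of_slabEngine (hE : SlabEngine) : ApexOfDecayingCore := by
  rintro ⟨C', N, q, H, hsws, hgrad, hI, hnt, hdecay⟩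
  -- `0 ≤ C'` from the decay at one point
  have hC' : 0 ≤ C' := by
    have h := hdecay (-1) (by norm_num) 0
    have hden : 0 < 1 + ‖(0 : E³)‖ + Real.sqrt (-(-1 : ℝ)) := by positivity
    have := (norm_nonneg _).trans h
    exact (div_nonneg_iff.1 this).elim (fun h => h.1) fun h => absurd h.2 (not_le.2 hden)
  have hF : ∀ c : ℝ, 1 ≤ c → ∀ t : ℝ, t < 0 → ∀ x : E³,
      ‖c • N (c ^ 2 * t) (c • x)‖ ≤ C' / (‖x‖ + Real.sqrt (-t)) := by
    intro c hc t ht x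
    have hc0 : 0 < c := by linarith
    have hct : c ^ 2 * t < 0 := mul_neg_of_pos_of_neg (by positivity) ht
    have key := hdecay (c ^ 2 * t) hct (c • x)
    have hsq : Real.sqrt (-(c ^ 2 * t)) = c * Real.sqrt (-t) := by
      rw [show -(c ^ 2 * t) = c ^ 2 * -t by ring, Real.sqrt_mul (sq_nonneg c), Real.sqrt_sq hc0.le]
    rw [norm_smul, Real.norm_of_nonneg hc0.le, hsq] at key
    rw [norm_smul, Real.norm_of_nonneg hc0.le]
    have hst : 0 < Real.sqrt (-t) := Real.sqrt_pos.2 (by linarith)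
    have hden1 : 0 < 1 + c * ‖x‖ + c * Real.sqrt (-t) := by positivity
    have hden2 : 0 < ‖x‖ + Real.sqrt (-t) := by positivity
    calc c * ‖N (c ^ 2 * t) (c • x)‖ ≤ c * (C' / (1 + c * ‖x‖ + c * Real.sqrt (-t))) :=
          mul_le_mul_of_nonneg_left key hc0.le
      _ ≤ C' / (‖x‖ + Real.sqrt (-t)) := by
          rw [mul_div_assoc', div_le_div_iff₀ hden1 hden2]
          nlinarith [norm_nonneg x, hst.le]
  obtain ⟨u, p, G, hsws', hgrad', hI', hsing, hae⟩ :=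
    blowDown_of_slabEngine (F := fun w => C' / (‖w.2‖ + Real.sqrt (-w.1))) hE hsws hgrad hI hnt hF
  have hae' : ∀ᵐ w ∂(volume.restrict (Iio (0 : ℝ) ×ˢ (univ : Set E³))),
      ‖u w.1 w.2‖ ≤ C' / (‖w.2‖ + Real.sqrt (-w.1)) :=
    hae.mono fun w hw => by simpa [Function.uncurry] using hw
  obtain ⟨u', -, h1, h2, h3, h4, h5⟩ := exists_apex_profile_repr hC' hsws' hgrad' hI' hsing hae'
  exact ⟨C', u', p, G, h1, h2, h3, h4, h5⟩

/-- **A–B reverse WITH the rate, modulo the engine**: every non-trivial member of 𝒜(C,B) yields a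
rate-Type-I singular slab profile (`F = C/√(−t)` is scale-invariant; `exists_rate_profile_repr`). -/
theorem classGivesRateProfile_of_slabEngine (hE : SlabEngine) : ClassGivesRateProfile := by
  rintro C B M ⟨hcont, -, -, -, hrate, q, H, hsws, hgrad, hI⟩ ⟨s, hs, y, hy⟩
  have hnt := not_ae_eq_zero_of_continuousOn_slab hcont hs hy
  have hC : 0 ≤ C := by
    have h := hrate (-1) (by norm_num) (0 : E³)
    have hden : 0 < Real.sqrt (-(-1 : ℝ)) := Real.sqrt_pos.2 (by norm_num)
    have := (norm_nonneg _).trans h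
    exact (div_nonneg_iff.1 this).elim (fun h => h.1) fun h => absurd h.2 (not_le.2 hden)
  have hF : ∀ c : ℝ, 1 ≤ c → ∀ t : ℝ, t < 0 → ∀ x : E³,
      ‖c • M (c ^ 2 * t) (c • x)‖ ≤ C / Real.sqrt (-t) := fun c hc t ht x =>
    (hrate.nsRescale (by linarith : 0 < c)) t ht x
  obtain ⟨u, p, G, hsws', hgrad', hI', hsing, hae⟩ :=
    blowDown_of_slabEngine (F := fun w => C / Real.sqrt (-w.1)) hE hsws hgrad hI hnt hF
  have hae' : ∀ᵐ w ∂(volume.restrict (Iio (0 : ℝ) ×ˢ (univ : Set E³))),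
      ‖u w.1 w.2‖ ≤ C / Real.sqrt (-w.1) :=
    hae.mono fun w hw => by simpa [Function.uncurry] using hw
  obtain ⟨u', -, h1, h2, h3, h4, h5⟩ := exists_rate_profile_repr hC hsws' hgrad' hI' hsing hae'
  exact ⟨C, u', p, G, h1, h2, h3, h4, h5⟩

/-! ## §3 Packaging: the bet versus the crux, engine granted -/

/-- **Engine granted, under the route target the bet ⇔ the crux** (the ⇒ transfer and hull closure
are the remaining known inputs). -/
theorem bet_iff_crux_of_target (hE : SlabEngine) (h1 : RateToAncientCore) (h4 : HullClosureCore)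
    (hX : RellichScar.NoApexTypeIProfile) : HullSelectionCore ↔ RellichScar.ApexLocalisation :=
  hullSelectionCore_iff_crux_of_target h1 h4 (apexOfDecayingCore_of_slabEngine hE)
    (classGivesRateProfile_of_slabEngine hE) hX

/-- **Engine granted, a failure of the bet either exhibits an apex profile (route dead) or kills the
crux.** -/
theorem bet_failure_dichotomy (hE : SlabEngine) (h3 : ¬ HullSelectionCore) :
    ApexProfileExists ∨ ¬ RellichScar.ApexLocalisation :=
  apexProfileExists_or_not_crux_of_not_hullSelectionCore (classGivesRateProfile_of_slabEngine hE) h3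

/-! ### Conformance with the skeleton (textual; the `Lines/` module is not importable)

`stub_rateToAncient = SlabEngine → RateToAncientCore`, `stub_hullSelection = RB → HullSelectionCore`,
`stub_hullClosed = SlabEngine → HullClosureCore`, `stub_apexOfDecaying = SlabEngine → ApexOfDecayingCore`,
each by `Iff.rfl` once `InBridgeClass` is unfolded (it is the inlined conjunction verbatim). The full
type of `stub_apexOfDecaying`, restated verbatim and closed by §2: -/
example :
    (∀ (I : ℝ≥0∞) (v : ℕ → ℝ → E³ → E³) (q : ℕ → ℝ → E³ → ℝ) (G : ℕ → ℝ → E³ → E³ →L[ℝ] E³),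
      I < ⊤ →
      (∀ k, IsSuitableWeakSolutionOn (slab E³ (Iio 0) isOpen_Iio) 1 0 (v k) (q k)) →
      (∀ k, HasWeakSpatialGradientOn (slab E³ (Iio 0) isOpen_Iio) (v k) (G k)) →
      (∀ k, typeIBound (Iio (0 : ℝ) ×ˢ univ) (v k) (q k) (G k) ≤ I) →
      ∃ (u : ℝ → E³ → E³) (p : ℝ → E³ → ℝ) (H : ℝ → E³ → E³ →L[ℝ] E³) (σ : ℕ → ℕ),
        StrictMono σ ∧
        IsSuitableWeakSolutionOn (slab E³ (Iio 0) isOpen_Iio) 1 0 u p ∧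
        HasWeakSpatialGradientOn (slab E³ (Iio 0) isOpen_Iio) u H ∧
        typeIBound (Iio (0 : ℝ) ×ˢ univ) u p H ≤ 4 * I ∧
        (∀ R : ℝ, 0 < R → Tendsto (fun j => eLpNorm (uncurry (v (σ j)) - uncurry u) 3
          (volume.restrict (parabolicCylinder R (0 : ℝ × E³)))) atTop (𝓝 0)) ∧
        ((∀ R : ℝ, 0 < R → limsup (fun j => eLpNorm (uncurry (v (σ j))) ⊤
            (volume.restrict (parabolicCylinder R (0 : ℝ × E³)))) atTop = ⊤) →
          IsBackwardSingularPoint u 0)) →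
    (∃ (C' : ℝ) (N : ℝ → E³ → E³) (q : ℝ → E³ → ℝ) (H : ℝ → E³ → E³ →L[ℝ] E³),
      IsSuitableWeakSolutionOn (slab E³ (Iio 0) isOpen_Iio) 1 0 N q ∧
      HasWeakSpatialGradientOn (slab E³ (Iio 0) isOpen_Iio) N H ∧
      typeIBound (Iio (0 : ℝ) ×ˢ univ) N q H < ⊤ ∧
      ¬ (uncurry N =ᵐ[volume.restrict (Iio (0 : ℝ) ×ˢ (univ : Set E³))] 0) ∧
      ∀ t : ℝ, t < 0 → ∀ x : E³, ‖N t x‖ ≤ C' / (1 + ‖x‖ + Real.sqrt (-t))) →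
    ∃ (C' : ℝ) (u : ℝ → E³ → E³) (p : ℝ → E³ → ℝ) (G : ℝ → E³ → E³ →L[ℝ] E³),
      IsSuitableWeakSolutionOn (slab E³ (Iio 0) isOpen_Iio) 1 0 u p ∧
      HasWeakSpatialGradientOn (slab E³ (Iio 0) isOpen_Iio) u G ∧
      typeIBound (Iio (0 : ℝ) ×ˢ univ) u p G < ⊤ ∧ HasTypeIDecay C' u ∧
      IsBackwardSingularPoint u 0 :=
  fun hE h => apexOfDecayingCore_of_slabEngine hE h


/-- Conformance: the full type of `stub_rateToAncient`, verbatim, is `SlabEngine → RateToAncientCore`. -/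
example :
    ((∀ (I : ℝ≥0∞) (v : ℕ → ℝ → E³ → E³) (q : ℕ → ℝ → E³ → ℝ) (G : ℕ → ℝ → E³ → E³ →L[ℝ] E³),
      I < ⊤ →
      (∀ k, IsSuitableWeakSolutionOn (slab E³ (Iio 0) isOpen_Iio) 1 0 (v k) (q k)) →
      (∀ k, HasWeakSpatialGradientOn (slab E³ (Iio 0) isOpen_Iio) (v k) (G k)) →
      (∀ k, typeIBound (Iio (0 : ℝ) ×ˢ univ) (v k) (q k) (G k) ≤ I) →
      ∃ (u : ℝ → E³ → E³) (p : ℝ → E³ → ℝ) (H : ℝ → E³ → E³ →L[ℝ] E³) (σ : ℕ → ℕ),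
        StrictMono σ ∧
        IsSuitableWeakSolutionOn (slab E³ (Iio 0) isOpen_Iio) 1 0 u p ∧
        HasWeakSpatialGradientOn (slab E³ (Iio 0) isOpen_Iio) u H ∧
        typeIBound (Iio (0 : ℝ) ×ˢ univ) u p H ≤ 4 * I ∧
        (∀ R : ℝ, 0 < R → Tendsto (fun j => eLpNorm (uncurry (v (σ j)) - uncurry u) 3
          (volume.restrict (parabolicCylinder R (0 : ℝ × E³)))) atTop (𝓝 0)) ∧
        ((∀ R : ℝ, 0 < R → limsup (fun j => eLpNorm (uncurry (v (σ j))) ⊤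
            (volume.restrict (parabolicCylinder R (0 : ℝ × E³)))) atTop = ⊤) →
          IsBackwardSingularPoint u 0)) →
    ∀ C : ℝ,
      (∃ (u : ℝ → E³ → E³) (p : ℝ → E³ → ℝ) (G : ℝ → E³ → E³ →L[ℝ] E³),
        IsSuitableWeakSolutionOn (slab E³ (Iio 0) isOpen_Iio) 1 0 u p ∧
        HasWeakSpatialGradientOn (slab E³ (Iio 0) isOpen_Iio) u G ∧
        typeIBound (Iio (0 : ℝ) ×ˢ univ) u p G < ⊤ ∧ HasTypeITimeDecay C u ∧
        IsBackwardSingularPoint u 0) →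
      ∃ (B : ℝ) (M : ℝ → E³ → E³),
        (ContinuousOn (uncurry M) (Iio (0 : ℝ) ×ˢ univ) ∧
          (∀ t < 0, IsWeaklyDivFree (M t)) ∧
          (∀ s t : ℝ, s < t → t < 0 → ∀ x : E³,
            M t x = UnboundedOperators.heatExtension (M s) (t - s) x - oseenDuhamel 1 s M M t x) ∧
          (∀ t < 0, ∀ x : E³, ‖M t x‖ ≤ B) ∧
          HasTypeITimeDecay C M ∧
          (∃ (q : ℝ → E³ → ℝ) (H : ℝ → E³ → E³ →L[ℝ] E³),
            IsSuitableWeakSolutionOn (slab E³ (Iio 0) isOpen_Iio) 1 0 M q ∧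
            HasWeakSpatialGradientOn (slab E³ (Iio 0) isOpen_Iio) M H ∧
            typeIBound (Iio (0 : ℝ) ×ˢ univ) M q H < ⊤)) ∧
        (∃ s : ℝ, s < 0 ∧ ∃ y : E³, M s y ≠ 0)) ↔
    (SlabEngine → RateToAncientCore) :=
  Iff.rfl

/-- Conformance: the full type of `stub_hullSelection`, verbatim, is "radiation bound → `HullSelectionCore`". -/
example :
    ((∃ c₀ : ℝ, ∀ (I B : ℝ) (M : ℝ → E³ → E³), 0 ≤ I →
      ContinuousOn (uncurry M) (Iio (0 : ℝ) ×ˢ univ) →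
      (∀ t < 0, ∀ x : E³, ‖M t x‖ ≤ B) →
      (∀ τ < 0, ∀ (z : E³) (r : ℝ), 0 < r → ∫ y in ball z r, ‖M τ y‖ ^ 2 ≤ I * r) →
      ∀ (s t : ℝ), s < t → t < 0 → ∀ x : E³, x ≠ 0 →
        ‖∫ τ in Ioo s t, ∫ y in {y : E³ | ‖x‖ / 2 ≤ ‖y - x‖},
            oseenKernel (t - τ) (x - y) (M τ y) (M τ y)‖ ≤ c₀ * I / ‖x‖) →
    ∀ (C B : ℝ) (M : ℝ → E³ → E³),
      (ContinuousOn (uncurry M) (Iio (0 : ℝ) ×ˢ univ) ∧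
        (∀ t < 0, IsWeaklyDivFree (M t)) ∧
        (∀ s t : ℝ, s < t → t < 0 → ∀ x : E³,
          M t x = UnboundedOperators.heatExtension (M s) (t - s) x - oseenDuhamel 1 s M M t x) ∧
        (∀ t < 0, ∀ x : E³, ‖M t x‖ ≤ B) ∧
        HasTypeITimeDecay C M ∧
        (∃ (q : ℝ → E³ → ℝ) (H : ℝ → E³ → E³ →L[ℝ] E³),
          IsSuitableWeakSolutionOn (slab E³ (Iio 0) isOpen_Iio) 1 0 M q ∧
          HasWeakSpatialGradientOn (slab E³ (Iio 0) isOpen_Iio) M H ∧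
          typeIBound (Iio (0 : ℝ) ×ˢ univ) M q H < ⊤)) →
      (∃ s : ℝ, s < 0 ∧ ∃ y : E³, M s y ≠ 0) →
      ∃ (xk : ℕ → E³) (tk : ℕ → ℝ) (lk : ℕ → ℝ) (N : ℝ → E³ → E³),
        (∀ k, tk k ≤ 0 ∧ 0 < lk k ∧ lk k ≤ 1) ∧
        (∀ t < 0, TendstoLocallyUniformly
          (fun k (y : E³) => lk k • M (tk k + lk k ^ 2 * t) (xk k + lk k • y)) (N t) atTop) ∧
        ContinuousOn (uncurry N) (Iio (0 : ℝ) ×ˢ univ) ∧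
        (∃ s : ℝ, s < 0 ∧ ∃ y : E³, N s y ≠ 0) ∧
        ∃ K : ℝ, ∀ s < 0, ∀ y : E³, ‖y‖ * ‖N s y‖ ≤ K) ↔
    ((∃ c₀ : ℝ, ∀ (I B : ℝ) (M : ℝ → E³ → E³), 0 ≤ I →
      ContinuousOn (uncurry M) (Iio (0 : ℝ) ×ˢ univ) →
      (∀ t < 0, ∀ x : E³, ‖M t x‖ ≤ B) →
      (∀ τ < 0, ∀ (z : E³) (r : ℝ), 0 < r → ∫ y in ball z r, ‖M τ y‖ ^ 2 ≤ I * r) →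
      ∀ (s t : ℝ), s < t → t < 0 → ∀ x : E³, x ≠ 0 →
        ‖∫ τ in Ioo s t, ∫ y in {y : E³ | ‖x‖ / 2 ≤ ‖y - x‖},
            oseenKernel (t - τ) (x - y) (M τ y) (M τ y)‖ ≤ c₀ * I / ‖x‖) → HullSelectionCore) :=
  Iff.rfl

/-- Conformance: the full type of `stub_hullClosed`, verbatim, is `SlabEngine → HullClosureCore`. -/
example :
    ((∀ (I : ℝ≥0∞) (v : ℕ → ℝ → E³ → E³) (q : ℕ → ℝ → E³ → ℝ) (G : ℕ → ℝ → E³ → E³ →L[ℝ] E³),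
      I < ⊤ →
      (∀ k, IsSuitableWeakSolutionOn (slab E³ (Iio 0) isOpen_Iio) 1 0 (v k) (q k)) →
      (∀ k, HasWeakSpatialGradientOn (slab E³ (Iio 0) isOpen_Iio) (v k) (G k)) →
      (∀ k, typeIBound (Iio (0 : ℝ) ×ˢ univ) (v k) (q k) (G k) ≤ I) →
      ∃ (u : ℝ → E³ → E³) (p : ℝ → E³ → ℝ) (H : ℝ → E³ → E³ →L[ℝ] E³) (σ : ℕ → ℕ),
        StrictMono σ ∧
        IsSuitableWeakSolutionOn (slab E³ (Iio 0) isOpen_Iio) 1 0 u p ∧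
        HasWeakSpatialGradientOn (slab E³ (Iio 0) isOpen_Iio) u H ∧
        typeIBound (Iio (0 : ℝ) ×ˢ univ) u p H ≤ 4 * I ∧
        (∀ R : ℝ, 0 < R → Tendsto (fun j => eLpNorm (uncurry (v (σ j)) - uncurry u) 3
          (volume.restrict (parabolicCylinder R (0 : ℝ × E³)))) atTop (𝓝 0)) ∧
        ((∀ R : ℝ, 0 < R → limsup (fun j => eLpNorm (uncurry (v (σ j))) ⊤
            (volume.restrict (parabolicCylinder R (0 : ℝ × E³)))) atTop = ⊤) →
          IsBackwardSingularPoint u 0)) →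
    ∀ (C B : ℝ) (M : ℝ → E³ → E³) (xk : ℕ → E³) (tk : ℕ → ℝ) (lk : ℕ → ℝ) (N : ℝ → E³ → E³),
      (ContinuousOn (uncurry M) (Iio (0 : ℝ) ×ˢ univ) ∧
        (∀ t < 0, IsWeaklyDivFree (M t)) ∧
        (∀ s t : ℝ, s < t → t < 0 → ∀ x : E³,
          M t x = UnboundedOperators.heatExtension (M s) (t - s) x - oseenDuhamel 1 s M M t x) ∧
        (∀ t < 0, ∀ x : E³, ‖M t x‖ ≤ B) ∧
        HasTypeITimeDecay C M ∧
        (∃ (q : ℝ → E³ → ℝ) (H : ℝ → E³ → E³ →L[ℝ] E³),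
          IsSuitableWeakSolutionOn (slab E³ (Iio 0) isOpen_Iio) 1 0 M q ∧
          HasWeakSpatialGradientOn (slab E³ (Iio 0) isOpen_Iio) M H ∧
          typeIBound (Iio (0 : ℝ) ×ˢ univ) M q H < ⊤)) →
      (∀ k, tk k ≤ 0 ∧ 0 < lk k ∧ lk k ≤ 1) →
      (∀ t < 0, TendstoLocallyUniformly
        (fun k (y : E³) => lk k • M (tk k + lk k ^ 2 * t) (xk k + lk k • y)) (N t) atTop) →
      ContinuousOn (uncurry N) (Iio (0 : ℝ) ×ˢ univ) →
      (ContinuousOn (uncurry N) (Iio (0 : ℝ) ×ˢ univ) ∧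
        (∀ t < 0, IsWeaklyDivFree (N t)) ∧
        (∀ s t : ℝ, s < t → t < 0 → ∀ x : E³,
          N t x = UnboundedOperators.heatExtension (N s) (t - s) x - oseenDuhamel 1 s N N t x) ∧
        (∀ t < 0, ∀ x : E³, ‖N t x‖ ≤ B) ∧
        HasTypeITimeDecay C N ∧
        (∃ (q : ℝ → E³ → ℝ) (H : ℝ → E³ → E³ →L[ℝ] E³),
          IsSuitableWeakSolutionOn (slab E³ (Iio 0) isOpen_Iio) 1 0 N q ∧
          HasWeakSpatialGradientOn (slab E³ (Iio 0) isOpen_Iio) N H ∧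
          typeIBound (Iio (0 : ℝ) ×ˢ univ) N q H < ⊤))) ↔
    (SlabEngine → HullClosureCore) :=
  Iff.rfl

end Summit.NavierStokesRegularity.NavierStokesRegularity.Theorems.ApexLocalisation.Negative
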